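import Mathlib
import HarnessLib
import Summits.ValiantsHypothesis.ValiantsHypothesis.Theses.MonotoneRestoration
import Literature.Computability.AlgebraicComplexity.ArithCircuitProofs
import Literature.Computability.AlgebraicComplexity.MonotoneStructure
import Literature.Computability.AlgebraicComplexity.PermanentIrreducible
import Literature.Computability.AlgebraicComplexity.StandardFamiliesProofs
import Literature.Barriers.ValiantsHypothesis.MonotoneGapPermanentLower
import Summits.ValiantsHypothesis.ValiantsHypothesis.Theorems.MonotoneRestorationQP.Negative.LoadBearing
import Summits.ValiantsHypothesis.ValiantsHypothesis.Theorems.MonotoneRestorationMonotoneRestorationQPTopComponentStructure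
import Summits.ValiantsHypothesis.ValiantsHypothesis.Theorems.MonotoneRestorationMonotoneRestorationQPPermSupportCount
import Summits.ValiantsHypothesis.ValiantsHypothesis.Theorems.MonotoneRestorationMonotoneRestorationQPBlockProjection
import Summits.ValiantsHypothesis.ValiantsHypothesis.Theorems.MonotoneRestorationMonotoneRestorationQPBiMultilinearOrbit
import Summits.ValiantsHypothesis.ValiantsHypothesis.Theorems.MonotoneRestorationMonotoneRestorationQPBiMultilinearShape
import Summits.ValiantsHypothesis.ValiantsHypothesis.Theorems.MonotoneRestorationMonotoneRestorationQPBetaArithmetic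
import Summits.ValiantsHypothesis.ValiantsHypothesis.Theorems.MonotoneRestorationMonotoneRestorationQPSparseRegime

/-!
# Theorem β — the bi-multilinear slice of `MonotoneRestorationQP` is TRUE (crux `stmt-ValiantsHypothesis-15886`)

Helper file (`--supports stmt-ValiantsHypothesis-15886`) of line `Sketch`, lead c2.  The crux
`Summit.ValiantsHypothesis.ValiantsHypothesis.Theses.MonotoneRestoration.MonotoneRestorationQP`
(monotone restoration at quasi-polynomial cost) restricted to families whose monomials use every
row and every column AT MOST ONCE ("bi-multilinear": sums `Σ_k a_k σ_k` of the `k`-matching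
polynomials) holds unconditionally, through a genuine monotone lower bound:

* `biMultilinear_two_pow_totalDegree_le` — for a matrix-symmetric bi-multilinear `f` over `NNReal`,
  `2 ^ deg f ≤ 64 · (L⁺(f) + 1)³ · (deg f + 1)⁶` (`L⁺` = tree `complexity` over the semiring
  `NNReal`).  Proof: project onto the top-left `k × k` block, `k = deg f` (B3, free for `L⁺`); the
  top homogeneous component of the projection is supported on exactly the `k!` permutation
  monomials (B4 orbit transport + B5 shape); the balanced decomposition of that component
  (B1, `≤ 4 L⁺ (k+1)²` terms, Yehudayoff / CDGM Thm 2.1 via gate quotients) and Jerrum–Snir's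
  partition count (B2) give `2^k ≤ (4 L⁺ (k+1)²)³`.
* `monotoneRestorationQP_of_biMultilinear` — THEOREM β: the crux verbatim with the extra
  bi-multilinearity hypothesis: the bound forces `deg f_n ≤ (log₂ n + c')^c'` (B6), and the
  polylog-degree regime is the landed `monotoneRestorationQP_of_polylogDegree` (p137433).
* `two_pow_le_complexity_perPoly` — by-product: the permanent needs monotone complexity
  `2^{n/3}/poly` in the tree's `complexity` model (the route-usable form of Jerrum–Snir 1982 §4.3,
  whose exact `⊗`-count form `JerrumSnir1982_permanent_holds` lives in the barrier catalogue).

Census consequence for the line: a counterexample to the crux must have monomials that REUSE a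
row or a column (the matching slice restores), besides degree `(log n)^{ω(1)}` (SparseRegime).
-/

-- `ValiantsHypothesis.ValiantsHypothesis`: the D-0017 layout repeats the problem name in the path.
set_option linter.dupNamespace false

noncomputable section

namespace Summit.ValiantsHypothesis.ValiantsHypothesis.Theorems

open Literature.Computability.AlgebraicComplexity MvPolynomial

namespace Beta

/-- Row degrees (`Finsupp.mapDomain Prod.fst`, the vocabulary of `IsOrdered`) agree with row
counts (`Σ_c m (r, c)`, the vocabulary of `permMonomial`). [folklore] -/
theorem rowDegrees_eq_rowCount {n : ℕ} (m : Fin n × Fin n →₀ ℕ) (i : Fin n) :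
    rowDegrees m i = rowCount m i := by
  classical
  unfold rowDegrees rowCount
  rw [Finsupp.mapDomain, Finsupp.sum_apply, Finsupp.sum_fintype _ _ (fun _ => by simp)]
  rw [Fintype.sum_prod_type]
  simp only [Finsupp.single_apply]
  rw [Finset.sum_eq_single i]
  · exact Finset.sum_congr rfl fun c _ => by simp
  · intro r _ hr
    exact Finset.sum_eq_zero fun c _ => if_neg hr
  · intro hi; exact absurd (Finset.mem_univ i) hi

/-- **Support of the top component of the block projection.** For a matrix-symmetric
bi-multilinear `f ≠ 0` of total degree `k ≤ n` and `g` its `k × k` block projection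
(coefficients `coeff d g = coeff (ι_* d) f`), the degree-`k` homogeneous component of `g` is
supported on exactly the permutation monomials. [folklore] -/
theorem mem_support_topComponent_iff {n : ℕ} (f : MvPolynomial (Fin n × Fin n) NNReal)
    (hsym : ∀ σ τ : Equiv.Perm (Fin n),
      MvPolynomial.rename (fun p : Fin n × Fin n => (σ p.1, τ p.2)) f = f)
    (hbi : ∀ m ∈ f.support, (∀ i, rowCount m i ≤ 1) ∧ (∀ j, colCount m j ≤ 1))
    (hf : f ≠ 0) {k : ℕ} (hk : f.totalDegree = k) (hkn : k ≤ n)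
    {g : MvPolynomial (Fin k × Fin k) NNReal}
    (hg : ∀ d : Fin k × Fin k →₀ ℕ, coeff d g = coeff (Finsupp.mapDomain
      (fun p : Fin k × Fin k => (Fin.castLE hkn p.1, Fin.castLE hkn p.2)) d) f)
    (m : Fin k × Fin k →₀ ℕ) :
    m ∈ (homogeneousComponent k g).support ↔ ∃ π : Equiv.Perm (Fin k), permMonomial π = m := by
  rw [mem_support_iff, coeff_homogeneousComponent]
  constructor
  · intro h
    have hdeg : m.degree = k := by
      by_contra hne
      exact h (if_neg hne)
    rw [if_pos hdeg, hg] at h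
    have hmem : Finsupp.mapDomain
        (fun p : Fin k × Fin k => (Fin.castLE hkn p.1, Fin.castLE hkn p.2)) m ∈ f.support :=
      mem_support_iff.2 h
    obtain ⟨hrow, hcol⟩ := hbi _ hmem
    obtain ⟨-, htr, htc⟩ := biMultilinearShape_transport n k hkn m
    refine biMultilinearShape_exists_permMonomial_eq k m (fun i => ?_) (fun j => ?_) hdeg
    · rw [← htr i]; exact hrow _
    · rw [← htc j]; exact hcol _
  · rintro ⟨π, rfl⟩
    rw [if_pos (Literature.Barriers.ValiantsHypothesis.JerrumSnir.degree_permMonomial π), hg]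
    exact mem_support_iff.1
      (stub_biMultilinear_blockPerm_mem_support f hsym hbi hf hk hkn π)

end Beta

open Beta in
/-- **The monotone lower bound behind Theorem β.** For a matrix-symmetric polynomial `f` over
`NNReal` in the `n × n` matrix variables whose monomials use every row and every column at most once,
`2 ^ deg f ≤ 64 · (L⁺(f) + 1)³ · (deg f + 1)⁶`, where `L⁺ = complexity` is the tree's
fan-in-two circuit complexity over the semiring `NNReal` (monotone complexity).  Block projection
(B3) + permutation support of the top component (B4/B5) + balanced decomposition (B1) +
Jerrum–Snir count (B2). [cite: JerrumSnir1982, §4.3]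
[cite: ChattopadhyayDattaGhosalMukhopadhyay2022, §2, Thm. 2.1] -/
theorem biMultilinear_two_pow_totalDegree_le {n : ℕ} (f : MvPolynomial (Fin n × Fin n) NNReal)
    (hsym : ∀ σ τ : Equiv.Perm (Fin n),
      MvPolynomial.rename (fun p : Fin n × Fin n => (σ p.1, τ p.2)) f = f)
    (hbi : ∀ m ∈ f.support, (∀ i, rowCount m i ≤ 1) ∧ (∀ j, colCount m j ≤ 1)) :
    2 ^ f.totalDegree ≤ 64 * (complexity f + 1) ^ 3 * (f.totalDegree + 1) ^ 6 := by
  set k := f.totalDegree with hkdef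
  have hR : 64 ≤ 64 * (complexity f + 1) ^ 3 * (k + 1) ^ 6 := by
    have h1 : 1 ≤ (complexity f + 1) ^ 3 := Nat.one_le_pow _ _ (by omega)
    have h2 : 1 ≤ (k + 1) ^ 6 := Nat.one_le_pow _ _ (by omega)
    calc 64 = 64 * 1 * 1 := by ring
      _ ≤ 64 * (complexity f + 1) ^ 3 * (k + 1) ^ 6 := Nat.mul_le_mul (Nat.mul_le_mul_left _ h1) h2
  by_cases hk3 : k < 3
  · calc 2 ^ k ≤ 2 ^ 3 := Nat.pow_le_pow_right (by norm_num) hk3.le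
      _ ≤ 64 := by norm_num
      _ ≤ _ := hR
  push Not at hk3
  -- `f ≠ 0` and `k ≤ n`
  have hf : f ≠ 0 := by
    rintro rfl
    rw [hkdef, totalDegree_zero] at hk3
    omega
  have hkn : k ≤ n := by
    rw [hkdef, totalDegree]
    refine Finset.sup_le fun m hm => ?_
    have := biMultilinearShape_degree_le n m (hbi m hm).1
    rwa [Finsupp.degree] at this
  -- B3: the block projection
  obtain ⟨g, hgc, hg⟩ := stub_blockProjection hkn f
  -- the top component of the projection is supported on the permutation monomials
  have hq : ∀ m, m ∈ (homogeneousComponent k g).support ↔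
      ∃ π : Equiv.Perm (Fin k), permMonomial π = m :=
    mem_support_topComponent_iff f hsym hbi hf hkdef.symm hkn hg
  have hord : IsFullyOrdered (homogeneousComponent (Fintype.card (Fin k)) g) := by
    rw [Fintype.card_fin]
    intro m hm i
    obtain ⟨π, rfl⟩ := (hq m).1 hm
    rw [rowDegrees_eq_rowCount, rowCount_permMonomial]
  -- B1: balanced decomposition of the top component of a minimal circuit for `g`
  obtain ⟨P, hP2, hPc, hPs⟩ := ArithCircuit.exists_computes_size_eq_complexity g
  have hk3' : 3 ≤ Fintype.card (Fin k) := by rwa [Fintype.card_fin]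
  obtain ⟨L, hLlen, hLsum, hL⟩ := stub_balancedDecomposition_topComponent P hP2 hPc hord hk3'
  rw [Fintype.card_fin] at hLlen hLsum hL
  -- B2: Jerrum–Snir's count
  have hcount : 2 ^ k ≤ L.length ^ 3 := stub_permSupport_decomposition_count hk3 hq L hLsum hL
  -- arithmetic
  have hlen : L.length ≤ 4 * (complexity f + 1) * (k + 1) ^ 2 := by
    calc L.length ≤ 4 * P.size * (k + 1) ^ 2 := hLlen
      _ ≤ 4 * (complexity f + 1) * (k + 1) ^ 2 := by
          apply Nat.mul_le_mul_right
          apply Nat.mul_le_mul_left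
          rw [hPs]; omega
  calc 2 ^ k ≤ L.length ^ 3 := hcount
    _ ≤ (4 * (complexity f + 1) * (k + 1) ^ 2) ^ 3 := Nat.pow_le_pow_left hlen 3
    _ = 64 * (complexity f + 1) ^ 3 * (k + 1) ^ 6 := by ring

/-- **THEOREM β — the bi-multilinear slice of the crux `MonotoneRestorationQP` is true.**  The
crux verbatim (matrix symmetry, polynomial degree and polynomial monotone complexity over `NNReal`
⇒ quasi-polynomial square-symmetric circuits over `ℂ`), restricted to families whose monomials
use every row and every column at most once: `biMultilinear_two_pow_totalDegree_le` forces
`deg f_n ≤ (log₂ n + c')^c'` (arithmetic `stub_betaArithmetic`), and the polylog-degree regime is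
`monotoneRestorationQP_of_polylogDegree`. [folklore] -/
theorem monotoneRestorationQP_of_biMultilinear :
    ∀ f : (n : ℕ) → MvPolynomial (Fin n × Fin n) NNReal,
    (∀ (n : ℕ) (σ τ : Equiv.Perm (Fin n)),
      MvPolynomial.rename (fun p : Fin n × Fin n => (σ p.1, τ p.2)) (f n) = f n) →
    (∀ n, ∀ m ∈ (f n).support, (∀ i, rowCount m i ≤ 1) ∧ (∀ j, colCount m j ≤ 1)) →
    (∃ c : ℕ, ∀ n : ℕ, (f n).totalDegree ≤ (n + 2) ^ c ∧
      complexity (k := NNReal) (f n) ≤ (n + 2) ^ c) →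
    ∃ c : ℕ, ∀ n : ℕ, ∃ (G : Type) (_ : Fintype G)
      (C : LabelledArithCircuit ℂ (Fin n × Fin n) Unit G),
      C.IsSymmetric (Equiv.Perm (Fin n)) ∧
      C.eval (C.output ()) = MvPolynomial.map (Complex.ofRealHom.comp NNReal.toRealHom) (f n) ∧
      Fintype.card G ≤ 2 ^ ((Nat.log 2 n + c) ^ c) := by
  intro f hsym hbi ⟨c, hc⟩
  obtain ⟨c', hc'⟩ := stub_betaArithmetic c
  refine monotoneRestorationQP_of_polylogDegree f hsym ⟨c', fun n => ?_⟩
  exact hc' n (f n).totalDegree (complexity (f n)) (hc n).2 (hc n).1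
    (biMultilinear_two_pow_totalDegree_le (f n) (hsym n) (hbi n))

/-- **The permanent is monotone-hard in the tree's `complexity` model**: `2 ^ n ≤
64 · (L⁺(per_n) + 1)³ · (n + 1)⁶`, i.e. `L⁺(per_n) ≥ 2^{n/3} / (4 (n+1)²) - 1` — the
route-usable (fan-in-two weighted circuits over the semiring `NNReal`) form of Jerrum–Snir's
§4.3; the exact `⊗`-count `n (2^{n-1} - 1)` for plain computations is
`JerrumSnir1982_permanent_holds` in the barrier catalogue. [cite: JerrumSnir1982, §4.3] -/
theorem two_pow_le_complexity_perPoly (n : ℕ) :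
    2 ^ n ≤ 64 * (complexity (perPoly (Fin n) NNReal) + 1) ^ 3 * (n + 1) ^ 6 := by
  have hdeg : (perPoly (Fin n) NNReal).totalDegree = n := by
    rw [totalDegree_perPoly_holds, Fintype.card_fin]
  have h := biMultilinear_two_pow_totalDegree_le (perPoly (Fin n) NNReal)
    (MonotoneRestorationQP.Negative.rename_perm_perPoly n) (fun m hm => ?_)
  · rwa [hdeg] at h
  · obtain ⟨σ, rfl⟩ :=
      (Literature.Barriers.ValiantsHypothesis.JerrumSnir.mem_support_perPoly NNReal).1 hm
    exact ⟨fun i => (rowCount_permMonomial σ i).le, fun j => (colCount_permMonomial σ j).le⟩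

end Summit.ValiantsHypothesis.ValiantsHypothesis.Theorems
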